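import Summits.QuantumFields.QCD.Theses.PauliWegnerSea
import Literature.MathematicalPhysics.QuantumFieldTheory.QCDPhaseQuenchedReweighting
import HarnessLib.Audit

/-!
# Line `sea-factorises-across-collars` for crux `PauliWegnerSea.FMClosureUnquenched`
# (stmt-QuantumFields-11512, K2 of route-QuantumFields-PauliWegnerSea, rank 4) — gen-2 reshape

Skeleton (crux-plan gen 2, planner-cruxplan-stmt-QuantumFields-11512-sea-factorises-acros-g2-0, 2026-08-16;
supersedes the gen-1 skeleton of …-acros-0 at the same path, git history keeps it) of the crux idea
`Ideas/sea-factorises-across-collars.md` (ideator 2, round 1; triage r1-1/2/3: pass, item 3 struck).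

The crux (route file rev 4, verbatim): `FibreCofactorDomination → TiltedFlatness → ∀ N_f reg m > 0,
INPUT(reg,m) → CONCL(reg,m)`; INPUT = one-scale torus-shell smallness `∀ q ∃ K₀ s ∀ᶠ k ∃ ℓ₀ ∈ [1, L_k]`
(log scale) `∀ S ≥ L_k: ℓ₀^q(1+|β_k|)^q E_{|w|,k,S}[(Σ|G_f(0,v)|)^s] ≤ 1 on ‖v‖ = ℓ₀`; CONCL = clause (ii) of
`MobilityGap`. `perMoment`, `Input`, `Concl` below are byte-identical re-packagings (`fmClosure_iff` is
`Iff.rfl`) and coincide with those of the sibling line `Lines/gamma5-square-positivity.lean`, as do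
`OutwardWith` / `Outward` (that line CONSUMES `Input → Outward`; this line PRODUCES it, `outward_of_line`).

## The line in one paragraph

Aizenman–Schenker–Friedrich–Hundertmark's finite-volume criterion (math-ph/9910022 Lemma 5, Lemma 6, proof
of Thm 2, pp. 6–8) run on the `|det D|`-tilted Wilson measure `ν` of the torus. Of its three ingredients, two
are fibre statements the route already bets on — the two-star conditional a-priori bound and the two-factor
decoupling (K1 in local form + K3, `stub_fibrePackage`) — and the third, the PRODUCT STEP `E[X·Y] = E[X]E[Y]`
(ASFH p. 7: "two independent random variables … the expectation now factorizes"), is where the tilt's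
non-locality bites (B3). The card's observation, taken literally at the scale of the bootstrap ball
`B = B_ℓ(x)` (its item 1 is the same remark at the two-star scale): CONDITIONALLY ON EVERY LINK OUTSIDE `B`,
the tilted law of the inside links is again `e^{-βS} · |det(D_B(U_in) - Σ_C)| · Haar` — the sea FACTORISES
ACROSS THE CUT exactly (Schur complement), the whole exterior `C` entering only through a boundary
self-energy `Σ_C = T₁ G_{Bᶜ}(C) T₁†` supported on the boundary layer and through the boundary plaquettes, with
the Peter–Weyl degree of the tilt per inside link UNCHANGED. Hence the input the iteration actually consumes is
the card's 4(i) read literally — the CONDITIONAL centre-to-sphere Dirichlet moment of the ball, uniformly in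
the exterior configuration (`LocalAt`, a demand on one ball with arbitrary boundary data: finite-dimensional,
T-deliverable by GoodShell + tilt-robust RareDislocations) — and with it the product step is Tonelli: no
independence, no collar remainder, no comparison measure. `stub_localisedInput` (B3, the hole the card names)
converts the typed AVERAGED shell input into `LocalAt`; `stub_outwardBootstrap` is ASFH Lemma 5/6 + Thm 2 on
the torus (entropy `ℓ⁶` and every `(1+|β_k|)^p ℓ^p` paid by the input's `∀q` room — THE ROOM IS USED THERE);
what no outward `s<1` bootstrap gives (Disproof §5 / B0: decay INSIDE the log shell with a k-uniform
prefactor) is the shared open stub `stub_inwardInterpolation`; the crux's soft corner (A5: `ℓ₀ = 1, |β_k| < 1`,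
no room) is `stub_unitShellCorner`. The corner split is PER `k` (`room_or_corner`, sorry-free), so regs that
visit the corner infinitely often without staying there are handled honestly (the gen-1 global split
`Input → InputR ∨ Concl` was crux-complete on such regs).

## Why the gen-1 lever stub (`CollarTransfer`, Cè–Giusti–Schaefer comparison) is gone

Its conclusion (inside smallness uniformly in the FAR exterior `Φ`, collar integrated) was to be proved by
"good collar ⇒ one-sided law ≈ conditional law; bad collars rare by AVERAGED cross-collar smallness". But the
ASFH product step applies it with `Φ` = the layer-cake events `{|G_{B'ᶜ}(v',y)|^s > t}` of the exterior factor,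
which PLANT near-zero modes of the exterior operator next to the collar: there `Σ_C` acquires a huge rank-one
part, the conditional inside law is cofactor-tilted (not comparable to `|det D_{B'}|`), and no averaged
hypothesis can make such `C` rare given `Φ` (which may be their indicator). The comparison route is blocked
exactly where it is used; what would rescue the statement there is smallness of the inside moment under the
cofactor-tilted conditional laws — i.e. `LocalAt` itself — so the comparison stub is redundant at best, and the
Schur form above shows it is unnecessary. What survives of the card is items 1, 4(i), 5 (and the CGS/Jacobi
identities of `SketchIdeator2` as the heuristic for WHY `LocalAt` is local in substance and as a tool for its
prover: on good collars `condE` IS close to the one-sided law).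

## Composition

`FMClosureUnquenched_of : S₁ → S₂ → S₃ → S₄ → S₅ → PauliWegnerSea.FMClosureUnquenched` (sorry-free): read the
crux through `fmClosure_iff`; `room_or_corner` splits the input per `k`; on room `k`'s
`S₂ ; S₃ ; S₄` give `ConclAt`, on corner `k`'s `S₅` does; exponents are made common by letting every producing
stub serve all small exponents, rates/prefactors merged by `conclAt_mono`. `FMClosureUnquenched_skeleton`
instantiates it with the five `stub_*`. `outward_of_line` certifies the OUTWARD HALF
(`K1 → K3 → ∀ …, Input → Outward`, the statement line `gamma5-square-positivity` consumes) modulo S₁ S₂ S₃ S₅.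

## Disproof.lean / negatives honoured

`Disproof.lean` (cdisprove cycles 1–1c) is not mounted in this seat's jail (`run/gate/evidence` absent,
`ledger crux cat … Disproof.lean`: none); used through its evidence notes: crux `= K1 → K3 → Core`
(`fmClosure_iff`, mirrored here as `Iff.rfl`) — K1, K3 are threaded BY NAME into S₁ S₂ S₄ S₅ and consumed in
`_of` ("the line uses K1 in LOCAL form and K3(a)/(b′) at `stub_fibrePackage`"); `core_imp_nnCriterion` (A5) —
isolated PER `k` as `CornerAt`/S₅, never hidden in the bootstrap; `coreRepaired_of_core` /
`smallness_of_repaired` — `RoomAt` carries the room `2^q` (`2 ≤ ℓ ∨ 1 ≤ |β_k|`); `not_abstractFMClosureRepaired`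
(§5, A6/B0) — S₃ claims decay only from the threshold `3ℓ+2` on, and the inward half is its own stub S₄ with
the k-uniform short-distance bound named as its content; §6 `outward_bootstrap` — the abstract iteration S₃
instantiates on the torus; "no Aharonov–Bohm cages" — K1 is used, not doubted. No `_false_without_` theorem and
no landed `Theorems/FMClosureUnquenched/Negative/` lemma exist (2026-08-16), so no stub can be an instance of
one. Negatives index (`ledger negatives --problem QuantumFields`: 9494, 9599, 9603, 9665 — MultibosonBridge root
ladders, diagonal-mirror RP, adaptive coarse system): untouched (no reflection positivity anywhere in this line).
-/

open scoped BigOperators ENNReal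
open MeasureTheory Filter
open Literature.MathematicalPhysics.QuantumFieldTheory Literature.MathematicalPhysics.QuantumLattice
  Literature.Probability.LatticeModels

noncomputable section

namespace Summit.QuantumFields.QCD.Cruxes.FMClosureUnquenched.SeaFactorisesAcrossCollars

open Classical

/-! ### §0a Vocabulary: quark-line blocks, depleted (Dirichlet) operators, balls, conditional laws -/

/-- `ℤ⁴` with the sup norm — the crux's `Literature.Probability.LatticeModels.Site 4`. -/
abbrev Z4 : Type := Literature.Probability.LatticeModels.Site 4

/-- `SU(3)` lattice gauge fields on the four-torus of side `N`. -/
abbrev Cfg (N : ℕ) : Type := GaugeConfig 4 N SU3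

section Operators

variable {Nf N : ℕ} [NeZero N]

/-- The torus site carried by a fermion index (flavour × (site × colour × spin)). -/
def siteOf (p : FermiIdx Nf N) : TorusSite 4 N := (quarkEquiv.symm p).2.1

/-- The colour–spin block `ℓ¹` norm `Σ_{a,i,b,j} |M_{(f,x,a,i),(f,y,b,j)}|` — the crux's `Σ|G_f(x,y)|`. -/
def blockNorm (M : Matrix (FermiIdx Nf N) (FermiIdx Nf N) ℂ) (f : Fin Nf) (x y : TorusSite 4 N) : ℝ :=
  ∑ a : Fin 3, ∑ i : Fin 4, ∑ b : Fin 3, ∑ j : Fin 4,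
    ‖M (quarkEquiv (f, (x, a, i))) (quarkEquiv (f, (y, b, j)))‖

/-- ASFH depletion along the cut set of `Ω` ("Dirichlet decoupling", math-ph/9910022 §2): the hopping terms
between `Ω` and its complement are switched off, so `depl Ω D = D_Ω ⊕ D_{Ωᶜ}` and
`(depl Ω D)⁻¹ = G_Ω ⊕ G_{Ωᶜ}` (junk `0` where singular, as everywhere in the route). `Ω = univ` gives `D`. -/
def depl (Ω : Finset (TorusSite 4 N)) (M : Matrix (FermiIdx Nf N) (FermiIdx Nf N) ℂ) :
    Matrix (FermiIdx Nf N) (FermiIdx Nf N) ℂ :=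
  Matrix.of fun p q => if (siteOf p ∈ Ω ↔ siteOf q ∈ Ω) then M p q else 0

/-- The star of a torus site: the positively oriented edges incident to it (as in the route's K1). -/
def EdgeStar (t : TorusSite 4 N) (e : Edge 4 N) : Prop := e.1 = t ∨ e.1.shift e.2 = t

/-- `F` depends only on the links on which `P` holds (measurability w.r.t. a set of links, stated pointwise). -/
def DependsOn {α : Type*} (P : Edge 4 N → Prop) (F : Cfg N → α) : Prop :=
  ∀ U U' : Cfg N, (∀ e, P e → U e = U' e) → F U = F U'

/-- Product Haar probability on all links of the torus. -/
def haarPi (N : ℕ) [NeZero N] : Measure (Cfg N) := Measure.pi fun _ : Edge 4 N => haarProbability SU3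

end Operators

section Balls

variable (S : ℕ) {Nf : ℕ}

/-- The sup-norm ball of radius `r` about (the projection of) `x₀ ∈ ℤ⁴` on the torus of side `2S+1`
(no wrap-around as long as `r ≤ S`). -/
def ball (x₀ : Z4) (r : ℕ) : Finset (TorusSite 4 (2 * S + 1)) :=
  (box 4 r).image fun v => Torus.proj (2 * S + 1) (x₀ + v)

/-- Edge with both endpoints in `B_r(x₀)` (an INSIDE link: exactly the links the Dirichlet operator
`depl (ball S x₀ r) D` restricted to the ball depends on). -/
def EdgeIn (x₀ : Z4) (r : ℕ) (e : Edge 4 (2 * S + 1)) : Prop :=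
  e.1 ∈ ball S x₀ r ∧ e.1.shift e.2 ∈ ball S x₀ r

/-- Override the INSIDE links of `B_r(x₀)` in `C` by those of `U` (the route's `refit`, for a ball). -/
def refitIn (x₀ : Z4) (r : ℕ) (C U : Cfg (2 * S + 1)) : Cfg (2 * S + 1) :=
  fun e => if EdgeIn S x₀ r e then U e else C e

/-- The FULL tilted weight `e^{-β S_W(V)} · |det D(V)|` of the torus (density of `ν` w.r.t. product Haar,
up to normalisation). -/
def tiltWeight (β : ℝ) (mq : Fin Nf → ℝ) (V : Cfg (2 * S + 1)) : ℝ :=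
  Real.exp (-(β * wilsonAction (fundamentalRep (Fin 3)) V)) * ‖(diracMatrix V mq).det‖

/-- `E_ν[X | everything outside B_ℓ(x₀) = C]`: the CONDITIONAL expectation of a function `X` of the gauge field
under the tilted measure `ν ∝ e^{-βS}|det D| dHaar`, given that every link which is not an inside link of
`B = B_ℓ(x₀)` agrees with `C` — written as the ratio of inside integrals of the full tilted weight with the
outside frozen (lower integrals, values in `ℝ≥0∞`: a non-integrable `X` shows as `∞`, never as Bochner junk).
STRUCTURE (exact, Schur complement of the inside block; the reason this is a LOCAL object): as a function of
the inside links, `|det D(refit C U)| = |det D_{Bᶜ}(C)| · |det(D_B(U_in) - Σ_C)|` with the boundary self-energy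
`Σ_C = T₁ G_{Bᶜ}(C) T₁†` (`T₁` the hops across `∂B`; valid whenever `D_{Bᶜ}(C)` is invertible, i.e. for all `C`
off a proper Zariski-closed set), so the conditional law is the Wilson law of the ball with
boundary data `C_∂` tilted by `|det(D_B - Σ_C)|`, a polynomial of the SAME Peter–Weyl bidegree `≤ (6N_f, 6N_f)`
in each inside link as `det D_B` — the exterior acts through finitely many boundary parameters only. -/
def condE (β : ℝ) (mq : Fin Nf → ℝ) (x₀ : Z4) (ℓ : ℕ) (C : Cfg (2 * S + 1))
    (X : Cfg (2 * S + 1) → ℝ) : ℝ≥0∞ :=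
  (∫⁻ U, ENNReal.ofReal (X (refitIn S x₀ ℓ C U) * tiltWeight S β mq (refitIn S x₀ ℓ C U))
      ∂(haarPi (2 * S + 1))) /
    ∫⁻ U, ENNReal.ofReal (tiltWeight S β mq (refitIn S x₀ ℓ C U)) ∂(haarPi (2 * S + 1))

/-- `⟨φ⟩₊` on the torus of side `2S+1`: the tree's phase-quenched expectation
`qcdPhaseQuenchedExpect β (2S+1) mq φ = ∫ |det D| φ dμ_W / ∫ |det D| dμ_W`
(`qcdPhaseQuenchedExpect_eq_div` is literally the crux's quotient). -/
abbrev pq (β : ℝ) (mq : Fin Nf → ℝ) (φ : Cfg (2 * S + 1) → ℝ) : ℝ :=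
  qcdPhaseQuenchedExpect β (2 * S + 1) mq φ

end Balls

/-! ### §0b Packaging of the crux's clause texts (shared verbatim with line `gamma5-square-positivity`) -/

section Packaging

variable {Nf : ℕ}

/-- The PHASE-QUENCHED FRACTIONAL MOMENT `E_{|w|}[(Σ_{a,i,b,j}|G_f(0,v)|)^s]` on the torus of side `2S+1` at
inverse coupling `β`, bare masses `mq`, exponent `s` — VERBATIM the quotient of Bochner integrals of clause (ii) /
of the one-scale input (identical text to `Gamma5SquarePositivity.perMoment`). -/
def perMoment (β : ℝ) (S : ℕ) (mq : Fin Nf → ℝ) (s : ℝ) (f : Fin Nf) (v : Literature.Probability.LatticeModels.Site 4) : ℝ :=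
  (∫ U : GaugeConfig 4 (2 * S + 1) (Matrix.specialUnitaryGroup (Fin 3) ℂ), ‖(diracMatrix U mq).det‖ * (∑ a : Fin 3, ∑ i : Fin 4, ∑ b : Fin 3, ∑ j : Fin 4, ‖(diracMatrix U mq)⁻¹ (quarkEquiv (f, (Torus.proj (2 * S + 1) 0, a, i))) (quarkEquiv (f, (Torus.proj (2 * S + 1) v, b, j)))‖) ^ s ∂(wilsonMeasure (fundamentalRep (Fin 3)) β)) / (∫ U : GaugeConfig 4 (2 * S + 1) (Matrix.specialUnitaryGroup (Fin 3) ℂ), ‖(diracMatrix U mq).det‖ ∂(wilsonMeasure (fundamentalRep (Fin 3)) β))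

/-- The crux's bare-mass trajectory `m_f(k) = m_crit(k) + a_k m_f / Z_m(k)`. -/
abbrev bare (reg : QCDRegularisation Nf) (m : Fin Nf → ℝ) (k : ℕ) : Fin Nf → ℝ :=
  fun fl => reg.mcrit k + reg.a k * m fl / reg.Zm k

/-- The ONE-SCALE INPUT of the crux for `(reg, m)` — verbatim. -/
def Input (reg : QCDRegularisation Nf) (m : Fin Nf → ℝ) : Prop :=
  ∀ q : ℕ, ∃ K₀ s : ℝ, 0 < s ∧ s < 1 ∧ ∀ᶠ k in atTop, ∃ ℓ₀ : ℕ, 1 ≤ ℓ₀ ∧ ℓ₀ ≤ reg.L k ∧ (ℓ₀ : ℝ) * reg.a k ≤ K₀ * (1 + |Real.log (reg.a k)|) ∧ ∀ S : ℕ, reg.L k ≤ S → ∀ (f : Fin Nf) (v : Literature.Probability.LatticeModels.Site 4), v ∈ box 4 S → ‖v‖ = (ℓ₀ : ℝ) → (ℓ₀ : ℝ) ^ q * (1 + |reg.β k|) ^ q * (perMoment (reg.β k) S (fun fl => reg.mcrit k + reg.a k * m fl / reg.Zm k) s f v) ≤ 1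

/-- Clause (ii) of `MobilityGap` for `(reg, m)` — the crux's conclusion, verbatim. -/
def Concl (reg : QCDRegularisation Nf) (m : Fin Nf → ℝ) : Prop :=
  ∃ s δ C : ℝ, 0 < s ∧ s < 1 ∧ 0 < δ ∧ ∀ᶠ k in atTop, ∀ S : ℕ, reg.L k ≤ S → ∀ (f : Fin Nf) (v : Literature.Probability.LatticeModels.Site 4), v ∈ box 4 S → perMoment (reg.β k) S (fun fl => reg.mcrit k + reg.a k * m fl / reg.Zm k) s f v ≤ C * Real.exp (-(δ * (reg.a k * ‖v‖)))

/-- The crux re-read through the packaging (definitional): `K1 → K3 → ∀ N_f reg m > 0, Input → Concl`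
(mirrors the disprover's `fmClosure_iff`). -/
theorem fmClosure_iff :
    Summit.QuantumFields.QCD.Theses.PauliWegnerSea.FMClosureUnquenched ↔
      (Summit.QuantumFields.QCD.Theses.PauliWegnerSea.FibreCofactorDomination →
        Summit.QuantumFields.QCD.Theses.PauliWegnerSea.TiltedFlatness →
          ∀ (Nf : ℕ) (reg : QCDRegularisation Nf) (m : Fin Nf → ℝ), (∀ f, 0 < m f) → Input reg m → Concl reg m) :=
  Iff.rfl

/-! ### §0c Per-`k` predicates (the bootstrap runs at each large `k` separately; constants are `k`-uniform) -/

/-- The input's shell clause at scale `ℓ`, step `k`, room exponent `q`, moment exponent `s`: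
`ℓ^q (1+|β_k|)^q · E_{|w|,k,S}[(Σ|G_f(0,v)|)^s] ≤ 1` for all `S ≥ L_k`, `f`, `‖v‖ = ℓ`. -/
def ShellAt (reg : QCDRegularisation Nf) (m : Fin Nf → ℝ) (q : ℕ) (s : ℝ) (k ℓ : ℕ) : Prop :=
  ∀ S : ℕ, reg.L k ≤ S → ∀ (f : Fin Nf) (v : Literature.Probability.LatticeModels.Site 4), v ∈ box 4 S →
    ‖v‖ = (ℓ : ℝ) → (ℓ : ℝ) ^ q * (1 + |reg.β k|) ^ q * (perMoment (reg.β k) S (bare reg m k) s f v) ≤ 1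

/-- ROOM at step `k`: a log-scale witness shell `ℓ ∈ [1, L_k]` of the averaged input with room exponent `q`
that carries GENUINE room, `ℓ^q(1+|β_k|)^q ≥ 2^q` (`2 ≤ ℓ`, or `ℓ = 1` but `|β_k| ≥ 1`) — the refuters'
`2 ≤ ℓ₀` repair (Disproof `coreRepaired_of_core`) made per-`k` and slightly more generous. -/
def RoomAt (reg : QCDRegularisation Nf) (m : Fin Nf → ℝ) (q : ℕ) (K₀ s : ℝ) (k : ℕ) : Prop :=
  ∃ ℓ : ℕ, 1 ≤ ℓ ∧ ℓ ≤ reg.L k ∧ (2 ≤ ℓ ∨ 1 ≤ |reg.β k|) ∧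
    (ℓ : ℝ) * reg.a k ≤ K₀ * (1 + |Real.log (reg.a k)|) ∧ ShellAt reg m q s k ℓ

/-- CORNER at step `k` (refuter A5 / Disproof `core_imp_nnCriterion`): the witness shell is the unit shell and
`|β_k| < 1`, so the room factor is `≤ 2^q` and all the typed input says is the threshold-free nearest-neighbour
criterion `E_{|w|,k,S}[(Σ|G_f(0,v)|)^s] ≤ 1` on `‖v‖ = 1`, for all `S ≥ L_k`. -/
def CornerAt (reg : QCDRegularisation Nf) (m : Fin Nf → ℝ) (s : ℝ) (k : ℕ) : Prop :=
  |reg.β k| < 1 ∧ 1 ≤ reg.L k ∧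
    ∀ S : ℕ, reg.L k ≤ S → ∀ (f : Fin Nf) (v : Literature.Probability.LatticeModels.Site 4), v ∈ box 4 S →
      ‖v‖ = 1 → perMoment (reg.β k) S (bare reg m k) s f v ≤ 1

/-- THE LOCALISED (CONDITIONAL, CENTRED) INPUT at step `k` — the card's item 4(i) read literally, the
hypothesis the ASFH iteration actually consumes: a log-scale radius `ℓ ∈ [1, L_k]` with room such that on every
torus `S ≥ L_k`, for every flavour, every sphere point `‖u‖ = ℓ` and EVERY configuration `C` of the links that
are not inside links of `B = B_ℓ(0)`, the conditional `s`-moment of the DIRICHLET ball propagator from the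
centre to `u` is small with room: `ℓ^q(1+|β_k|)^q · E_ν[(Σ|G_B(0,u)|)^s | outside = C] ≤ 1`. (By the Schur
structure recorded at `condE` this is a statement about ONE ball with arbitrary boundary gauge data and
arbitrary boundary self-energy — finite-dimensional uniformity, not far-field mixing.) -/
def LocalAt (reg : QCDRegularisation Nf) (m : Fin Nf → ℝ) (q : ℕ) (K₀ s : ℝ) (k : ℕ) : Prop :=
  ∃ ℓ : ℕ, 1 ≤ ℓ ∧ ℓ ≤ reg.L k ∧ (2 ≤ ℓ ∨ 1 ≤ |reg.β k|) ∧
    (ℓ : ℝ) * reg.a k ≤ K₀ * (1 + |Real.log (reg.a k)|) ∧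
    ∀ S : ℕ, reg.L k ≤ S → ∀ (f : Fin Nf) (u : Z4), ‖u‖ = (ℓ : ℝ) → ∀ C : Cfg (2 * S + 1),
      condE S (reg.β k) (bare reg m k) 0 ℓ C (fun U =>
          (blockNorm ((depl (ball S 0 ℓ) (diracMatrix U (bare reg m k)))⁻¹) f
            (Torus.proj (2 * S + 1) 0) (Torus.proj (2 * S + 1) u)) ^ s) ≤
        ENNReal.ofReal (((ℓ : ℝ) ^ q * (1 + |reg.β k|) ^ q)⁻¹)

/-- OUTWARD DECAY at step `k` with exposed constants: clause (ii) at `k` restricted to `‖v‖ ≥ ℓ'` for some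
threshold of at most logarithmic scale, `ℓ' a_k ≤ K₁(1+|log a_k|)` (the body of
`Gamma5SquarePositivity.OutwardWith`). -/
def DecayAt (reg : QCDRegularisation Nf) (m : Fin Nf → ℝ) (s δ C K₁ : ℝ) (k : ℕ) : Prop :=
  ∃ ℓ : ℕ, (ℓ : ℝ) * reg.a k ≤ K₁ * (1 + |Real.log (reg.a k)|) ∧ ∀ S : ℕ, reg.L k ≤ S →
    ∀ (f : Fin Nf) (v : Literature.Probability.LatticeModels.Site 4), v ∈ box 4 S → (ℓ : ℝ) ≤ ‖v‖ →
      perMoment (reg.β k) S (fun fl => reg.mcrit k + reg.a k * m fl / reg.Zm k) s f v ≤ C * Real.exp (-(δ * (reg.a k * ‖v‖)))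

/-- OUTWARD DECAY with exposed constants, eventually in `k` (identical to `Gamma5SquarePositivity.OutwardWith`). -/
def OutwardWith (reg : QCDRegularisation Nf) (m : Fin Nf → ℝ) (s δ C K₁ : ℝ) : Prop :=
  ∀ᶠ k in atTop, DecayAt reg m s δ C K₁ k

/-- The OUTWARD HALF of clause (ii) for `(reg, m)` (identical to `Gamma5SquarePositivity.Outward`; refuter A6's
second reading of (ii) — what every outward bootstrap delivers). -/
def Outward (reg : QCDRegularisation Nf) (m : Fin Nf → ℝ) : Prop :=
  ∃ s δ C K₁ : ℝ, 0 < s ∧ s < 1 ∧ 0 < δ ∧ 0 < C ∧ OutwardWith reg m s δ C K₁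

/-- Clause (ii) AT STEP `k` with constants `(s, δ, C)` (the body of `Concl`). -/
def ConclAt (reg : QCDRegularisation Nf) (m : Fin Nf → ℝ) (s δ C : ℝ) (k : ℕ) : Prop :=
  ∀ S : ℕ, reg.L k ≤ S → ∀ (f : Fin Nf) (v : Literature.Probability.LatticeModels.Site 4), v ∈ box 4 S →
    perMoment (reg.β k) S (fun fl => reg.mcrit k + reg.a k * m fl / reg.Zm k) s f v ≤ C * Real.exp (-(δ * (reg.a k * ‖v‖)))

end Packaging

/-! ### §0d The fibre package (the route's two-star technology in the form the bootstrap consumes) -/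

/-- **Fibre package** (conclusion of `stub_fibrePackage`). For every `N_f` there are `s₀, C, p > 0` such that for
all `0 < s ≤ s₀`, all `β ∈ ℝ`, all bare masses, every torus of side `2S+1 ≥ 5` (K1/K3 speak for side `≥ 4`;
the bootstrap only meets `S ≥ L_k → ∞`), all site sets `Ω, Ω′` (depleted =
Dirichlet-decoupled operators; `Ω = univ` is the full operator), flavours, sites `x, y, x′, y′` and every test
function `0 ≤ Ψ ≤ 1` depending only on links OFF the two stars of `x` and `y`:
(0) INTEGRABILITY: the product of the two `s`-powers of block norms is `μ_W`-integrable (poles of restricted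
determinants are not cancelled by the tilt: this is the `s ≤ s₀` restriction, r1-2 (a); with the bounded factor
`|G|^s|det D|^s = |adj|^s` it covers every two- and three-factor product the bootstrap meets);
(a) TWO-STAR CONDITIONAL A-PRIORI BOUND `⟨|G_Ω(x,y)|^s Ψ⟩₊ ≤ C(1+|β|)^p ⟨Ψ⟩₊` — the conditional `s`-moment given
everything off `star(x) ∪ star(y)` is bounded, uniformly in the volume and the outside (K1 in LOCAL form + K3(a)
+ Jensen on `|adj|^s|det|^{1-s}`; diagonal `x = y` included; unbounded off-star weights follow by truncation);
(c) FIBRE DECOUPLING (ASFH's `R₂` / Lemma "decoupling inequalities"): a second resolvent factor with arbitrary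
endpoints rides along, `⟨|G_Ω(x,y)|^s |G_{Ω′}(x′,y′)|^s Ψ⟩₊ ≤ C(1+|β|)^p ⟨|G_{Ω′}(x′,y′)|^s Ψ⟩₊`. -/
def FibrePackage : Prop :=
  ∀ Nf : ℕ, ∃ s₀ C p : ℝ, 0 < s₀ ∧ 0 < C ∧
    ∀ s : ℝ, 0 < s → s ≤ s₀ →
    ∀ (β : ℝ) (mq : Fin Nf → ℝ) (S : ℕ), 2 ≤ S → ∀ (Ω Ω' : Finset (TorusSite 4 (2 * S + 1)))
      (f f' : Fin Nf) (x y x' y' : TorusSite 4 (2 * S + 1)) (Ψ : Cfg (2 * S + 1) → ℝ),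
      Measurable Ψ → (∀ U, 0 ≤ Ψ U ∧ Ψ U ≤ 1) →
      DependsOn (fun e => ¬ EdgeStar x e ∧ ¬ EdgeStar y e) Ψ →
      Integrable (fun U : Cfg (2 * S + 1) =>
          (blockNorm ((depl Ω (diracMatrix U mq))⁻¹) f x y) ^ s *
            (blockNorm ((depl Ω' (diracMatrix U mq))⁻¹) f' x' y') ^ s)
        (wilsonMeasure (d := 4) (L := 2 * S + 1) (fundamentalRep (Fin 3)) β) ∧
      pq S β mq (fun U => (blockNorm ((depl Ω (diracMatrix U mq))⁻¹) f x y) ^ s * Ψ U) ≤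
        C * (1 + |β|) ^ p * pq S β mq Ψ ∧
      pq S β mq (fun U => (blockNorm ((depl Ω (diracMatrix U mq))⁻¹) f x y) ^ s *
          ((blockNorm ((depl Ω' (diracMatrix U mq))⁻¹) f' x' y') ^ s * Ψ U)) ≤
        C * (1 + |β|) ^ p *
          pq S β mq (fun U => (blockNorm ((depl Ω' (diracMatrix U mq))⁻¹) f' x' y') ^ s * Ψ U)

/-! ### §1 Registered stubs -/

/-- **Stub 1 — fibre package (L; the two-star technology of the route, in the form the bootstrap consumes).**
`K1 → K3 → FibrePackage`. Why plausibly true: on a two-star fibre the tilted conditional law is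
`∝ e^{−βS}|det D(W)| dW` (Schur again: `|det(D_stars(W) − Σ_outside)|`) and `|G|^s|det D| = |adj|^s|det|^{1−s}`,
so Jensen + K1-type domination + K3(a) flatness give (a) with NO small balls for full operators (card item 1,
checked by all three triagers, r1-3 ▶: `E_fib Π_{i≤k}|G_i|^s ≤ (sup_fib|adj|/M)^{ks}`, `x^{1−ks}` concave);
Dirichlet-restricted operators and (c) need the (b′)-type relative small balls / Remez lower bounds for
band-limited functions of bidegree `≤ (6N_f,6N_f)` per link on `≤ 16` links (fixed dimension ⇒ degree-only
constants; card `von-mises-circles`, r1-1 App. B, r1-3 ▶(b) conditional iteration), and the B5 surface-band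
caveat costs only polynomial factors (r1-1). WHAT IS REALLY ASKED (refuter A7 / r1-3 cross-cutting): the
constant must be VOLUME-UNIFORM, so K1 must be used in LOCAL form (window count of a ball operator + `e^{−MR}`
tail — the route's foreseen ModeByMode split); the typed K1 carries the global `n_w ∝ S⁴` and does NOT suffice
as a black box; the diagonal `x = y` needs the one-star analogue; and the statement is RANGE-BLIND (all `β ∈ ℝ`
with `(1+|β|)^p`, all bare masses) where K1/K3 speak only for `β ≥ 0`, `m₀ ∈ [−2,2]` — off that range the same
type arguments must be redone (heavy masses: Neumann series), or the tenure planner adds refuter g44-0's range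
hypothesis to K2. Size: L in Lean. Leans on: route items `FibreCofactorDomination` (11510, local form),
`TiltedFlatness` (14070 = (b′)), `PauliBandLimit`/`SingleLink(Log)Flatness` (11514–11516); tree
`qcdPhaseQuenchedExpect_*`, `wilsonDirac_gammaFive_hermitian_holds`; ESS doi:10.4171/jems/451 §3. -/
theorem stub_fibrePackage :
    Summit.QuantumFields.QCD.Theses.PauliWegnerSea.FibreCofactorDomination →
      Summit.QuantumFields.QCD.Theses.PauliWegnerSea.TiltedFlatness → FibrePackage := by
  sorry

/-- **Stub 2 — the localised input (B3, the missing implication the card names; open; the line's OWN hardest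
stub).** `K1 → K3 → FibrePackage → ∀ N_f reg m > 0, ∀ q ∃ Q ∀ K₀ s ∃ K₀′ s′, ∀ᶠ k, RoomAt Q K₀ s k → LocalAt q K₀′ s′ k`:
at each large `k`, the AVERAGED torus-shell bound with room exponent `Q` (at the origin, shell `ℓ₀(k)`) implies
the CONDITIONAL centre-to-sphere Dirichlet-ball bound with room exponent `q`, uniformly in the exterior
configuration `C`, at some log-scale radius `ℓ(k)` (the prover chooses `Q ≫ q`, `s′ ≤ s`, `K₀′`). This is the
card's item 4(i) / `BarrierNotesIdeator2` B3 made a statement — "one ball, arbitrary boundary data, one scale"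
(the triage's why-easier) — and it is EXACTLY what the ASFH product step consumes (`stub_outwardBootstrap`).
Why plausibly true: by the Schur structure (`condE`) the exterior enters only through boundary plaquettes and a
boundary self-energy `Σ_C`; frustrated boundary data force dislocations only within `O(1)` layers of the sphere
(gauge healing), which cost `O(1)·poly` at the `u`-end (two-star conditional bounds hold under ANY
conditioning); centre-to-sphere propagation crosses the bulk, where GoodShell (admissibility ⇒ deterministic
Combes–Thomas, tilt-blind) + RareDislocations (rare under `e^{−βS} × |bounded-degree polynomial|`, degree-only
flatness) give smallness for EVERY `C` — the same mechanism T would use for the averaged input. Why it might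
fail: "averaged ⇏ uniform" is false in the abstract (rare exteriors with `O(1)` conditional moment are
invisible to the torus mean: Boundary RN factors are `e^{±cℓ³β}`, never summable against `ℓ^{−q}` — B3), so no
proof can go through the averaged input as a black box; regs for which the `|det|` tilt itself is what
localises (input true, quenched-like conditional laws delocalised) would falsify it; and `∀ reg` includes
`β_k ≫ log(1/a_k)` where no large-field bound helps (r1-3). RECOMMENDED RE-CUT (tenure, recorded by the card and
all three triagers): let `OneScaleTrajectory` DELIVER `∀ q … ∀ᶠ k, LocalAt q K₀ s k` (its GoodShell →
RareDislocations split produces it at no extra cost); then this stub is moot. Size: open. Leans on: tree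
`wilsonMeasure_map_torusConfigShift` (if translation is wanted), `HJLLocality` (named fact), Disproof §6. -/
theorem stub_localisedInput :
    Summit.QuantumFields.QCD.Theses.PauliWegnerSea.FibreCofactorDomination →
      Summit.QuantumFields.QCD.Theses.PauliWegnerSea.TiltedFlatness → FibrePackage →
        ∀ (Nf : ℕ) (reg : QCDRegularisation Nf) (m : Fin Nf → ℝ), (∀ f, 0 < m f) →
          ∀ q : ℕ, ∃ Q : ℕ, ∀ K₀ s : ℝ, 0 < s → s < 1 →
            ∃ K₀' s' : ℝ, 0 < s' ∧ s' < 1 ∧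
              ∀ᶠ k in atTop, RoomAt reg m Q K₀ s k → LocalAt reg m q K₀' s' k := by
  sorry

/-- **Stub 3 — the outward bootstrap on the torus (L; ASFH Lemma 5 + Lemma 6 + Thm 2, Disproof §6).**
`FibrePackage → ∀ N_f ∃ q ∀ reg m > 0 ∀ K₀ s ∃ s̄ ∀ s′ ≤ s̄ ∃ δ C K₁, ∀ᶠ k, LocalAt q K₀ s k → DecayAt s′ δ C K₁ k`.
At a room step `k` with localised input at radius `ℓ` (level `ε = ℓ^{−q}(1+|β_k|)^{−q} ≤ 2^{−q}`), for
`F(x,y) := ⟨(Σ|G_f(x,y)|)^{s′}⟩₊` on the torus of side `2S+1 ≥ 2L_k+1`: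
(1) ASFH's second-order resolvent identity with ASFH's OWN geometry `W = B_ℓ(x)`, `Γ₁ = Γ(W)`, `Γ₂ = Γ(W⁺)`
(no thick collar is needed any more): `G(x,y) = Σ Σ G_W(x,u) T G(u′,v) T G_{(W⁺)ᶜ}(v′,y)`;
(2) the middle (full) factor is removed by FibrePackage (a) given everything off `star(u′) ∪ star(v)` (the two
outer factors are off-star measurable; unbounded weights by truncation);
(3) PRODUCT STEP = Tonelli: `Y = |G_{(W⁺)ᶜ}(v′,y)|^{s′}` is measurable w.r.t. links that are not inside links of
`W`, so `E_ν[X·Y] = E_ν[E_ν[X | outside] · Y] ≤ ε · E_ν[Y]` by `LocalAt` (translated from the origin to `x` by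
`torusConfigShift` covariance of `condE`, `depl`, `ball`, `wilsonAction`, `det`; `haarPi` = product over inside
× outside links, `MeasureTheory.measurePreserving_piEquivPiSubtypeProd`; `condE ≤ ε` clears denominators since
the tilted weight is bounded) — this is the step where ASFH use independence (p. 7) and where the gen-1 collar
transfer sat;
(4) closure `G_{(W⁺)ᶜ} → G` (Lemma 6) by FibrePackage (c);
(5) entropy `|Γ(W)||Γ(W⁺)| ≲ ℓ⁶` and all `C(1+|β_k|)^p` are paid by `q` (THE ROOM IS USED HERE: `q` is this stub's
to choose, depending on `N_f` through `s₀, C, p` only), exponents lowered to `s′ ≤ min(s, s₀)` by Jensen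
(`qcdPhaseQuenchedExpect_jensen`), giving one-step subharmonicity `F(x,y) ≤ b_k max_{‖w−x‖≤ℓ+1} F(w,y)` with
`b_k ≤ ℓ^{c−q s′/s}(1+|β_k|)^{p−q s′/s} < 1` whenever the torus distance exceeds `ℓ+1`;
(6) iteration on the torus (no boundary: Thm-1 style, `⌊‖v‖/(ℓ+2)⌋` steps; balls never wrap because the claim
is vacuous unless `S ≥ ‖v‖∞ ≥ 3ℓ+2`), the a-priori bound `A_k = C(1+|β_k|)^p` absorbed into ONE factor `b_k`,
output: `DecayAt s′ δ C K₁ k` with threshold `3ℓ+2` (`K₁ = 3K₀+2`), `δ = (q s′/s − c)/(3K₀)`-type physical rate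
(the logs cancel in the RATE), `C = 1`. Why it might fail: only through its hypotheses — the step is
deterministic bookkeeping once (0), (a), (c) and `LocalAt` hold. Size: L in Lean (resolvent identities for
`depl`, disintegration of `haarPi`, translation covariance, the geometric iteration on `(ZMod (2S+1))⁴`).
Leans on: `AizenmanEtAl2001` Lemma 5/6, Thm 1/2 (pp. 6–8); tree `torusConfigShift`,
`wilsonAction_torusConfigShift`, `wilsonMeasure_map_torusConfigShift`, `qcdPhaseQuenchedExpect_eq_div`,
`_jensen`, `_mono`, `isOpenPosMeasure_wilsonMeasure_fundamental`; Disproof §6 `outward_bootstrap` (abstract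
iteration, to be imported by the lead once it lands as a helper). -/
theorem stub_outwardBootstrap :
    FibrePackage → ∀ Nf : ℕ, ∃ q : ℕ, ∀ (reg : QCDRegularisation Nf) (m : Fin Nf → ℝ), (∀ f, 0 < m f) →
      ∀ K₀ s : ℝ, 0 < s → s < 1 →
        ∃ sb : ℝ, 0 < sb ∧ sb < 1 ∧ ∀ s' : ℝ, 0 < s' → s' ≤ sb →
          ∃ δ C K₁ : ℝ, 0 < δ ∧ 0 < C ∧
            ∀ᶠ k in atTop, LocalAt reg m q K₀ s k → DecayAt reg m s' δ C K₁ k := by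
  sorry

/-- **Stub 4 — inward interpolation (A6 / B0; HARDEST, open-problem; shared with every outward line).**
`K1 → K3 → FibrePackage → ∀ N_f reg m > 0 ∀ (room data) (outward data) ∃ s̄ ∀ s′ ≤ s̄ ∃ δ C, ∀ᶠ k,
RoomAt … k → DecayAt … k → ConclAt s′ δ C k`. The typed (ii) asks `E ≤ C e^{−δ a_k‖v‖}` with `k`-UNIFORM `C` for
ALL `v`, i.e. also inside the log shell: at `‖v‖ = O(1)` a `k`-uniform short-distance a-priori bound
(FibrePackage gives only `(1+|β_k|)^p`), and on `c/a_k ≲ ‖v‖ < (3ℓ+2)` genuine smallness `a_k^{δK₁‖v‖/ℓ}` which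
no outward bootstrap supplies (Disproof §5 `not_abstractFMClosureRepaired`, `BarrierNotesIdeator2` B0: a power
law `‖v‖^{−q′}` with `q′ > δK₁` on the window suffices; free-field scaling `E ~ ‖v‖^{−3s′}` says it is there).
Known mechanism: Lüscher transfer-matrix positivity ⇒ log-convexity of the phase-quenched pion correlator along
an axis + Hölder sandwich — ONLY on the reflection-positive locus (even `N_f`, pairwise degenerate masses
`> −1`, `0 ≤ β_k ≲ log(1/a_k)`, `a_kL_k ≫ log(1/a_k)`), where line `gamma5-square-positivity` PROVES this stub
modulo its own five stubs (its `concl_of_rpLocus`; our `Input` is implied by `RoomAt`-eventually); for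
`N_f = 3` (used by `closes`) or split masses NO mechanism is known (B1), and the honest alternative is the tenure
restatement of (ii) (`C·a_k^{−p}` or `‖v‖ ≥ ℓ(k)`), under which this stub is vacuous. Why it might fail: as a
statement it is true iff (ii) is, given outward decay — it fails only if short-distance fractional moments
genuinely grow along some regularisation satisfying the input (e.g. `β_k → ∞` non-AF with the measure NOT
concentrating on smooth fields), which would refute the crux itself in that scope. Size: open-problem. -/
theorem stub_inwardInterpolation :
    Summit.QuantumFields.QCD.Theses.PauliWegnerSea.FibreCofactorDomination →
      Summit.QuantumFields.QCD.Theses.PauliWegnerSea.TiltedFlatness → FibrePackage →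
        ∀ (Nf : ℕ) (reg : QCDRegularisation Nf) (m : Fin Nf → ℝ), (∀ f, 0 < m f) →
          ∀ (q : ℕ) (K₀ s s₁ δ₁ C₁ K₁ : ℝ), 0 < s → s < 1 → 0 < s₁ → s₁ < 1 → 0 < δ₁ → 0 < C₁ →
            ∃ sb : ℝ, 0 < sb ∧ sb < 1 ∧ ∀ s' : ℝ, 0 < s' → s' ≤ sb →
              ∃ δ C : ℝ, 0 < δ ∧ 0 < C ∧
                ∀ᶠ k in atTop, RoomAt reg m q K₀ s k → DecayAt reg m s₁ δ₁ C₁ K₁ k →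
                  ConclAt reg m s' δ C k := by
  sorry

/-- **Stub 5 — the unit-shell corner (A5; the crux's own soft corner, isolated PER `k`).**
`K1 → K3 → FibrePackage → ∀ N_f reg m > 0 ∀ s ∃ s̄ ∀ s′ ≤ s̄ ∃ δ C, ∀ᶠ k, CornerAt s k → ConclAt s′ δ C k`: at the
steps `k` where the typed input degenerates to the threshold-free nearest-neighbour criterion
`E_{|w|,k,S}[(Σ|G_f(0,v)|)^s] ≤ 1` on `‖v‖ = 1` with `|β_k| < 1` (Disproof `core_imp_nnCriterion`; refuter A5),
clause (ii) at `k` must be proved OUTRIGHT, with constants uniform over such `k`. Plausible because numerically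
the unit-shell criterion lies strictly inside the hopping-convergent region (`κ* ≈ 0.113 < 1/8`, kit j006913;
then `HoppingExpansionLocality_holds` gives a `k`-independent lattice gap and (ii) at `k` follows since
`δ a_k → 0`), but NOT provable by any known inequality for all `N_f` and bare masses (80 shell sites, constant
`1`, no Simon–Lieb margin; `|β_k| < 1` is strong coupling but the masses are unconstrained). Expected to be
MOOTED by the tenure restatement `2 ≤ ℓ₀` of K2/T (then `CornerAt` never occurs eventually and this stub is
vacuous); until then it is a refuter target as much as a prover target. Size: M outside the genuinely open core. -/
theorem stub_unitShellCorner :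
    Summit.QuantumFields.QCD.Theses.PauliWegnerSea.FibreCofactorDomination →
      Summit.QuantumFields.QCD.Theses.PauliWegnerSea.TiltedFlatness → FibrePackage →
        ∀ (Nf : ℕ) (reg : QCDRegularisation Nf) (m : Fin Nf → ℝ), (∀ f, 0 < m f) →
          ∀ s : ℝ, 0 < s → s < 1 →
            ∃ sb : ℝ, 0 < sb ∧ sb < 1 ∧ ∀ s' : ℝ, 0 < s' → s' ≤ sb →
              ∃ δ C : ℝ, 0 < δ ∧ 0 < C ∧
                ∀ᶠ k in atTop, CornerAt reg m s k → ConclAt reg m s' δ C k := by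
  sorry

/-! ### §2 Composition (no `sorry` below this line) -/

section Glue

variable {Nf : ℕ}

/-- `perMoment ≥ 0` (a quotient of integrals of non-negative functions). -/
theorem perMoment_nonneg (β : ℝ) (S : ℕ) (mq : Fin Nf → ℝ) (s : ℝ) (f : Fin Nf)
    (v : Literature.Probability.LatticeModels.Site 4) : 0 ≤ perMoment β S mq s f v := by
  unfold perMoment
  apply div_nonneg
  · exact integral_nonneg fun U => mul_nonneg (norm_nonneg _)
      (Real.rpow_nonneg (Finset.sum_nonneg fun _ _ => Finset.sum_nonneg fun _ _ =>
        Finset.sum_nonneg fun _ _ => Finset.sum_nonneg fun _ _ => norm_nonneg _) _)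
  · exact integral_nonneg fun U => norm_nonneg _

/-- **The per-`k` corner split of the typed input** (sorry-free): at each large `k` the witness shell either
carries room (`2 ≤ ℓ₀`, or `|β_k| ≥ 1`) or is the unit shell at `|β_k| < 1`, where the typed bound says
`perMoment ≤ 1` (the room factor is `≥ 1`). -/
theorem room_or_corner (reg : QCDRegularisation Nf) (m : Fin Nf → ℝ) (hin : Input reg m) (q : ℕ) :
    ∃ K₀ s : ℝ, 0 < s ∧ s < 1 ∧ ∀ᶠ k in atTop, RoomAt reg m q K₀ s k ∨ CornerAt reg m s k := by
  obtain ⟨K₀, s, hs, hs1, hev⟩ := hin q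
  refine ⟨K₀, s, hs, hs1, ?_⟩
  filter_upwards [hev] with k hk
  obtain ⟨ℓ₀, h1, hL, hlog, hshell⟩ := hk
  by_cases hr : 2 ≤ ℓ₀ ∨ 1 ≤ |reg.β k|
  · exact Or.inl ⟨ℓ₀, h1, hL, hr, hlog, hshell⟩
  · right
    push Not at hr
    obtain ⟨hℓ2, hβ⟩ := hr
    have hℓ1 : ℓ₀ = 1 := by omega
    subst hℓ1
    refine ⟨hβ, hL, fun S hS f v hv hnorm => ?_⟩
    have h := hshell S hS f v hv (by simpa using hnorm)
    have hP := perMoment_nonneg (reg.β k) S (fun fl => reg.mcrit k + reg.a k * m fl / reg.Zm k) s f v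
    have hone : (1 : ℝ) ≤ (1 + |reg.β k|) ^ q := one_le_pow₀ (by linarith [abs_nonneg (reg.β k)])
    simp only [Nat.cast_one, one_pow, one_mul] at h
    calc perMoment (reg.β k) S (fun fl => reg.mcrit k + reg.a k * m fl / reg.Zm k) s f v
        = 1 * perMoment (reg.β k) S (fun fl => reg.mcrit k + reg.a k * m fl / reg.Zm k) s f v := (one_mul _).symm
      _ ≤ (1 + |reg.β k|) ^ q * perMoment (reg.β k) S (fun fl => reg.mcrit k + reg.a k * m fl / reg.Zm k) s f v :=
          mul_le_mul_of_nonneg_right hone hP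
      _ ≤ 1 := h

/-- Monotonicity of the decay profile in the rate (as in the sibling line). -/
theorem exp_rate_mono {δ δ' x : ℝ} (h : δ' ≤ δ) (hx : 0 ≤ x) :
    Real.exp (-(δ * x)) ≤ Real.exp (-(δ' * x)) :=
  Real.exp_le_exp.mpr (neg_le_neg (mul_le_mul_of_nonneg_right h hx))

/-- `ConclAt` is monotone in (rate ↓, prefactor ↑). -/
theorem conclAt_mono (reg : QCDRegularisation Nf) (m : Fin Nf → ℝ) {s δ δ' C C' : ℝ} {k : ℕ}
    (hC : 0 < C) (hδ : δ' ≤ δ) (hCC : C ≤ C') (h : ConclAt reg m s δ C k) : ConclAt reg m s δ' C' k := by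
  intro S hS f v hv
  refine (h S hS f v hv).trans ?_
  have hx : 0 ≤ reg.a k * ‖v‖ := mul_nonneg (reg.a_pos k).le (norm_nonneg _)
  exact mul_le_mul hCC (exp_rate_mono hδ hx) (Real.exp_pos _).le (hC.le.trans hCC)

/-- `DecayAt` is monotone in (rate ↓, prefactor ↑, threshold constant ↑). -/
theorem decayAt_mono (reg : QCDRegularisation Nf) (m : Fin Nf → ℝ) {s δ δ' C C' K K' : ℝ} {k : ℕ}
    (hC : 0 < C) (hδ : δ' ≤ δ) (hCC : C ≤ C') (hKK : K ≤ K') (h : DecayAt reg m s δ C K k) :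
    DecayAt reg m s δ' C' K' k := by
  obtain ⟨ℓ, hℓ, h⟩ := h
  have hlog : 0 ≤ 1 + |Real.log (reg.a k)| := by linarith [abs_nonneg (Real.log (reg.a k))]
  refine ⟨ℓ, hℓ.trans (mul_le_mul_of_nonneg_right hKK hlog), fun S hS f v hv hvℓ => ?_⟩
  refine (h S hS f v hv hvℓ).trans ?_
  have hx : 0 ≤ reg.a k * ‖v‖ := mul_nonneg (reg.a_pos k).le (norm_nonneg _)
  exact mul_le_mul hCC (exp_rate_mono hδ hx) (Real.exp_pos _).le (hC.le.trans hCC)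

/-- Clause (ii) at `k` gives outward decay at `k` with threshold `0` and any `K₁ ≥ 0`. -/
theorem decayAt_of_conclAt (reg : QCDRegularisation Nf) (m : Fin Nf → ℝ) {s δ C K₁ : ℝ} {k : ℕ}
    (hK : 0 ≤ K₁) (h : ConclAt reg m s δ C k) : DecayAt reg m s δ C K₁ k := by
  refine ⟨0, ?_, fun S hS f v hv _ => h S hS f v hv⟩
  have hlog : 0 ≤ 1 + |Real.log (reg.a k)| := by linarith [abs_nonneg (Real.log (reg.a k))]
  simpa using mul_nonneg hK hlog

end Glue

/-- **`FMClosureUnquenched` from the five stubs** (kernel-checked, no `sorry` of its own; hypotheses are the stub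
statements, literally the types of `stub_fibrePackage`, `stub_localisedInput`, `stub_outwardBootstrap`,
`stub_inwardInterpolation`, `stub_unitShellCorner`). Read the crux through `fmClosure_iff`; `K1, K3` feed the
fibre package; `room_or_corner` splits the typed input per `k`; on room steps localise (S₂), bootstrap outward
(S₃, at its own top exponent), interpolate inward (S₄); on corner steps S₅; the two branches are given the common
exponent `t = min s̄₄ s̄₅` and merged rate/prefactor `min δ, max C`. -/
theorem FMClosureUnquenched_of
    (h₁ : Summit.QuantumFields.QCD.Theses.PauliWegnerSea.FibreCofactorDomination →
      Summit.QuantumFields.QCD.Theses.PauliWegnerSea.TiltedFlatness → FibrePackage)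
    (h₂ : Summit.QuantumFields.QCD.Theses.PauliWegnerSea.FibreCofactorDomination →
      Summit.QuantumFields.QCD.Theses.PauliWegnerSea.TiltedFlatness → FibrePackage →
        ∀ (Nf : ℕ) (reg : QCDRegularisation Nf) (m : Fin Nf → ℝ), (∀ f, 0 < m f) →
          ∀ q : ℕ, ∃ Q : ℕ, ∀ K₀ s : ℝ, 0 < s → s < 1 →
            ∃ K₀' s' : ℝ, 0 < s' ∧ s' < 1 ∧
              ∀ᶠ k in atTop, RoomAt reg m Q K₀ s k → LocalAt reg m q K₀' s' k)
    (h₃ : FibrePackage → ∀ Nf : ℕ, ∃ q : ℕ, ∀ (reg : QCDRegularisation Nf) (m : Fin Nf → ℝ), (∀ f, 0 < m f) →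
      ∀ K₀ s : ℝ, 0 < s → s < 1 →
        ∃ sb : ℝ, 0 < sb ∧ sb < 1 ∧ ∀ s' : ℝ, 0 < s' → s' ≤ sb →
          ∃ δ C K₁ : ℝ, 0 < δ ∧ 0 < C ∧
            ∀ᶠ k in atTop, LocalAt reg m q K₀ s k → DecayAt reg m s' δ C K₁ k)
    (h₄ : Summit.QuantumFields.QCD.Theses.PauliWegnerSea.FibreCofactorDomination →
      Summit.QuantumFields.QCD.Theses.PauliWegnerSea.TiltedFlatness → FibrePackage →
        ∀ (Nf : ℕ) (reg : QCDRegularisation Nf) (m : Fin Nf → ℝ), (∀ f, 0 < m f) →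
          ∀ (q : ℕ) (K₀ s s₁ δ₁ C₁ K₁ : ℝ), 0 < s → s < 1 → 0 < s₁ → s₁ < 1 → 0 < δ₁ → 0 < C₁ →
            ∃ sb : ℝ, 0 < sb ∧ sb < 1 ∧ ∀ s' : ℝ, 0 < s' → s' ≤ sb →
              ∃ δ C : ℝ, 0 < δ ∧ 0 < C ∧
                ∀ᶠ k in atTop, RoomAt reg m q K₀ s k → DecayAt reg m s₁ δ₁ C₁ K₁ k →
                  ConclAt reg m s' δ C k)
    (h₅ : Summit.QuantumFields.QCD.Theses.PauliWegnerSea.FibreCofactorDomination →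
      Summit.QuantumFields.QCD.Theses.PauliWegnerSea.TiltedFlatness → FibrePackage →
        ∀ (Nf : ℕ) (reg : QCDRegularisation Nf) (m : Fin Nf → ℝ), (∀ f, 0 < m f) →
          ∀ s : ℝ, 0 < s → s < 1 →
            ∃ sb : ℝ, 0 < sb ∧ sb < 1 ∧ ∀ s' : ℝ, 0 < s' → s' ≤ sb →
              ∃ δ C : ℝ, 0 < δ ∧ 0 < C ∧
                ∀ᶠ k in atTop, CornerAt reg m s k → ConclAt reg m s' δ C k) :
    Summit.QuantumFields.QCD.Theses.PauliWegnerSea.FMClosureUnquenched := by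
  refine fmClosure_iff.mpr ?_
  intro hK1 hK3 Nf reg m hm hin
  have hFP : FibrePackage := h₁ hK1 hK3
  obtain ⟨q, hq⟩ := h₃ hFP Nf
  obtain ⟨Q, hQ⟩ := h₂ hK1 hK3 hFP Nf reg m hm q
  obtain ⟨K₀, s, hs, hs1, hRC⟩ := room_or_corner reg m hin Q
  obtain ⟨K₀', s', hs', hs'1, hRL⟩ := hQ K₀ s hs hs1
  obtain ⟨sb₃, hsb₃, hsb₃1, hq3⟩ := hq reg m hm K₀' s' hs' hs'1
  obtain ⟨δ₁, C₁, K₁, hδ₁, hC₁, hLD⟩ := hq3 sb₃ hsb₃ le_rfl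
  obtain ⟨sb₄, hsb₄, hsb₄1, hq4⟩ :=
    h₄ hK1 hK3 hFP Nf reg m hm Q K₀ s sb₃ δ₁ C₁ K₁ hs hs1 hsb₃ hsb₃1 hδ₁ hC₁
  obtain ⟨sb₅, hsb₅, hsb₅1, hq5⟩ := h₅ hK1 hK3 hFP Nf reg m hm s hs hs1
  have ht0 : 0 < min sb₄ sb₅ := lt_min hsb₄ hsb₅
  have ht1 : min sb₄ sb₅ < 1 := lt_of_le_of_lt (min_le_left _ _) hsb₄1
  obtain ⟨δ₄, C₄, hδ₄, hC₄, hE4⟩ := hq4 (min sb₄ sb₅) ht0 (min_le_left _ _)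
  obtain ⟨δ₅, C₅, hδ₅, hC₅, hE5⟩ := hq5 (min sb₄ sb₅) ht0 (min_le_right _ _)
  refine ⟨min sb₄ sb₅, min δ₄ δ₅, max C₄ C₅, ht0, ht1, lt_min hδ₄ hδ₅, ?_⟩
  filter_upwards [hRC, hRL, hLD, hE4, hE5] with k hk₁ hk₂ hk₃ hk₄ hk₅
  show ConclAt reg m (min sb₄ sb₅) (min δ₄ δ₅) (max C₄ C₅) k
  rcases hk₁ with hroom | hcorner
  · exact conclAt_mono reg m hC₄ (min_le_left _ _) (le_max_left _ _) (hk₄ hroom (hk₃ (hk₂ hroom)))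
  · exact conclAt_mono reg m hC₅ (min_le_right _ _) (le_max_right _ _) (hk₅ hcorner)

/-- The crux modulo the five registered stubs (depends on their `sorry`s and on nothing else). -/
theorem FMClosureUnquenched_skeleton : Summit.QuantumFields.QCD.Theses.PauliWegnerSea.FMClosureUnquenched :=
  FMClosureUnquenched_of stub_fibrePackage stub_localisedInput stub_outwardBootstrap
    stub_inwardInterpolation stub_unitShellCorner

/-- **The OUTWARD HALF certified modulo S₁ S₂ S₃ S₅** (sorry-free logic): `K1 → K3 → ∀ N_f reg m > 0,
Input → Outward` — literally the statement the sibling line `gamma5-square-positivity` consumes as its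
`stub_outward` (same packaging), so the two lines compose: this line's bootstrap feeds that line's inward
positivity engine on the reflection-positive locus. Room steps: S₂ ; S₃. Corner steps: S₅ (clause (ii) at `k`
implies outward decay at `k` with threshold `0`). -/
theorem outward_of_line
    (h₁ : Summit.QuantumFields.QCD.Theses.PauliWegnerSea.FibreCofactorDomination →
      Summit.QuantumFields.QCD.Theses.PauliWegnerSea.TiltedFlatness → FibrePackage)
    (h₂ : Summit.QuantumFields.QCD.Theses.PauliWegnerSea.FibreCofactorDomination →
      Summit.QuantumFields.QCD.Theses.PauliWegnerSea.TiltedFlatness → FibrePackage →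
        ∀ (Nf : ℕ) (reg : QCDRegularisation Nf) (m : Fin Nf → ℝ), (∀ f, 0 < m f) →
          ∀ q : ℕ, ∃ Q : ℕ, ∀ K₀ s : ℝ, 0 < s → s < 1 →
            ∃ K₀' s' : ℝ, 0 < s' ∧ s' < 1 ∧
              ∀ᶠ k in atTop, RoomAt reg m Q K₀ s k → LocalAt reg m q K₀' s' k)
    (h₃ : FibrePackage → ∀ Nf : ℕ, ∃ q : ℕ, ∀ (reg : QCDRegularisation Nf) (m : Fin Nf → ℝ), (∀ f, 0 < m f) →
      ∀ K₀ s : ℝ, 0 < s → s < 1 →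
        ∃ sb : ℝ, 0 < sb ∧ sb < 1 ∧ ∀ s' : ℝ, 0 < s' → s' ≤ sb →
          ∃ δ C K₁ : ℝ, 0 < δ ∧ 0 < C ∧
            ∀ᶠ k in atTop, LocalAt reg m q K₀ s k → DecayAt reg m s' δ C K₁ k)
    (h₅ : Summit.QuantumFields.QCD.Theses.PauliWegnerSea.FibreCofactorDomination →
      Summit.QuantumFields.QCD.Theses.PauliWegnerSea.TiltedFlatness → FibrePackage →
        ∀ (Nf : ℕ) (reg : QCDRegularisation Nf) (m : Fin Nf → ℝ), (∀ f, 0 < m f) →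
          ∀ s : ℝ, 0 < s → s < 1 →
            ∃ sb : ℝ, 0 < sb ∧ sb < 1 ∧ ∀ s' : ℝ, 0 < s' → s' ≤ sb →
              ∃ δ C : ℝ, 0 < δ ∧ 0 < C ∧
                ∀ᶠ k in atTop, CornerAt reg m s k → ConclAt reg m s' δ C k) :
    Summit.QuantumFields.QCD.Theses.PauliWegnerSea.FibreCofactorDomination →
      Summit.QuantumFields.QCD.Theses.PauliWegnerSea.TiltedFlatness →
        ∀ (Nf : ℕ) (reg : QCDRegularisation Nf) (m : Fin Nf → ℝ), (∀ f, 0 < m f) →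
          Input reg m → Outward reg m := by
  intro hK1 hK3 Nf reg m hm hin
  have hFP : FibrePackage := h₁ hK1 hK3
  obtain ⟨q, hq⟩ := h₃ hFP Nf
  obtain ⟨Q, hQ⟩ := h₂ hK1 hK3 hFP Nf reg m hm q
  obtain ⟨K₀, s, hs, hs1, hRC⟩ := room_or_corner reg m hin Q
  obtain ⟨K₀', s', hs', hs'1, hRL⟩ := hQ K₀ s hs hs1
  obtain ⟨sb₃, hsb₃, hsb₃1, hq3⟩ := hq reg m hm K₀' s' hs' hs'1
  obtain ⟨sb₅, hsb₅, hsb₅1, hq5⟩ := h₅ hK1 hK3 hFP Nf reg m hm s hs hs1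
  have ht0 : 0 < min sb₃ sb₅ := lt_min hsb₃ hsb₅
  have ht1 : min sb₃ sb₅ < 1 := lt_of_le_of_lt (min_le_left _ _) hsb₃1
  obtain ⟨δ₃, C₃, K₃, hδ₃, hC₃, hE3⟩ := hq3 (min sb₃ sb₅) ht0 (min_le_left _ _)
  obtain ⟨δ₅, C₅, hδ₅, hC₅, hE5⟩ := hq5 (min sb₃ sb₅) ht0 (min_le_right _ _)
  refine ⟨min sb₃ sb₅, min δ₃ δ₅, max C₃ C₅, max K₃ 0, ht0, ht1, lt_min hδ₃ hδ₅,
    lt_max_of_lt_left hC₃, ?_⟩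
  filter_upwards [hRC, hRL, hE3, hE5] with k hk₁ hk₂ hk₃ hk₅
  rcases hk₁ with hroom | hcorner
  · exact decayAt_mono reg m hC₃ (min_le_left _ _) (le_max_left _ _) (le_max_left _ _)
      (hk₃ (hk₂ hroom))
  · exact decayAt_mono reg m hC₅ (min_le_right _ _) (le_max_right _ _) le_rfl
      (decayAt_of_conclAt reg m (le_max_right _ _) (hk₅ hcorner))

end Summit.QuantumFields.QCD.Cruxes.FMClosureUnquenched.SeaFactorisesAcrossCollars

end
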